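import Mathlib
import HarnessLib

/-!
# Rank one at a rational fibre, finite fields, constructible sets (crux `WildQuotients.WildQuotientResolution`, line `Sketch`)

Helper file 1/3 for stub `stub_birational_of_bijective` (lemma (L) of the skeleton `Sketch` for
crux stmt-ResolutionOfSingularities-15640): a finite étale morphism onto an integral scheme of
finite type and positive dimension over a field `k` which is bijective on points is birational.
The proof finds ONE point with trivial residue field extension by mapping a standard étale
chart to `𝔸¹_k` (Chevalley) and choosing a closed point of `𝔸¹_k` of suitable degree in the
image. This file provides the elementary inputs and the commutative-algebra heart.

Finite fields and constructible sets:

* `mem_of_pow_natCard_eq` — an element `x` of an extension `L` of a finite intermediate field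
  `F` with `x ^ |F| = x` lies in `F` (the roots of `X ^ |F| - X` in `L` are the elements of `F`);
* `natDegree_minpoly_eq_one_or_eq` — finite fields: if `β ∈ L` has PRIME degree `e` over `k`,
  then its degree over any intermediate field `F` is `1` or `e`
  (`[F(β) : F] = e / gcd(e, [F : k])`);
* `exists_irreducible_natDegree_eq` — over a finite field there are monic irreducible
  polynomials of every positive degree (minimal polynomial of a primitive element of
  Mathlib's `FiniteField.Extension k p n`);
* `exists_basicOpen_subset_of_isConstructible` — a constructible subset of the spectrum of a
  domain containing the generic point contains a non-empty basic open set.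

Rank one at a rational fibre:

* `rankAtStalk_eq_one_of_forall_exists` — `B` finite, flat and (formally) unramified over `A`,
  `t` a prime of `B` which is the ONLY prime over `u = t ∩ A`, and every `s ∈ B` congruent modulo
  `t` to a fraction `a / a'` (`a, a' ∈ A`, `a' ∉ u`). Then `rank_u B = 1`: the fibre ring
  `κ(u) ⊗_A B` is reduced (unramified over a field) with a single prime, which pulls back to `t`,
  so `1 ⊗ s = 0` for `s ∈ t` and `κ(u) → κ(u) ⊗_A B` is surjective, hence bijective;
* `algebraMap_mem_closure` — for a standard étale presentation (Mathlib
  `StandardEtalePresentation`: `S ≅ (A[X]/(f))[1/g]` with generator `x`) and a map `S → L` to a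
  field: if `x` lands in the subfield generated by the image of `A`, so does every element of `S`
  (it is `p(x) / g(x)ⁿ`);
* `exists_rankAtStalk_eq_one` (registered sub-goal) — consequently, for `B → S` over `A` with
  `Spec B → Spec A` injective, `B` has rank one at the prime `ker (A → L)`.

All statements are standard; no new definitions.
-/

-- single-problem summit: the doubled namespace component `ResolutionOfSingularities` is forced
set_option linter.dupNamespace false

namespace Summit.ResolutionOfSingularities.ResolutionOfSingularities.Theorems.WildQuotientResolution.Birational

open Polynomial TensorProduct
open scoped IntermediateField

/-- An element of a field extension `L` of a FINITE intermediate field `F` which is fixed by the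
`|F|`-th power map lies in `F`: the polynomial `X ^ |F| - X ∈ F[X]` splits in `F` with the
elements of `F` as roots, so its roots in `L` are the images of the elements of `F`.
[folklore] -/
theorem mem_of_pow_natCard_eq {k L : Type*} [Field k] [Field L] [Algebra k L]
    (F : IntermediateField k L) [Finite F] {x : L} (hx : x ^ Nat.card F = x) : x ∈ F := by
  classical
  letI : Fintype F := Fintype.ofFinite F
  have hcard : 1 < Fintype.card F := Fintype.one_lt_card
  set P : F[X] := X ^ Fintype.card F - X with hP
  have hroots : P.roots = Finset.univ.val := FiniteField.roots_X_pow_card_sub_X F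
  have hsplits : P.Splits := by
    rw [splits_iff_card_roots, hroots, FiniteField.X_pow_card_sub_X_natDegree_eq _ hcard]
    rfl
  have hne : P.map (algebraMap F L) ≠ 0 := by
    rw [hP, Polynomial.map_sub, Polynomial.map_pow, map_X]
    exact FiniteField.X_pow_card_sub_X_ne_zero L hcard
  have hxroot : x ∈ (P.map (algebraMap F L)).roots := by
    rw [mem_roots hne, IsRoot, eval_map, hP]
    simp [← Nat.card_eq_fintype_card, hx]
  rw [hsplits.roots_map (algebraMap F L), Multiset.mem_map] at hxroot
  obtain ⟨y, -, rfl⟩ := hxroot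
  exact y.2

/-- **Degrees over intermediate finite fields.** Let `k ⊆ L` be finite fields, `F` an
intermediate field and `β ∈ L` of PRIME degree `e` over `k`. Then the degree of `β` over `F` is
`1` or `e`: with `m = [F : k]` and `c = [F(β) : F]` one has `e ∣ m c` (as `k(β) ⊆ F(β)`) and
`c ≤ e`; if `e ∣ c` then `c = e`, and if `e ∣ m` then `β ^ |F| = β` (since `β ^ (|k| ^ e) = β`),
so `β ∈ F` and `c = 1`. [folklore] -/
theorem natDegree_minpoly_eq_one_or_eq {k L : Type*} [Field k] [Finite k] [Field L] [Algebra k L]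
    [Finite L] (F : IntermediateField k L) (β : L) {e : ℕ} (he : e.Prime)
    (hβ : (minpoly k β).natDegree = e) :
    (minpoly F β).natDegree = 1 ∨ (minpoly F β).natDegree = e := by
  classical
  haveI : Module.Finite k L := Module.Finite.of_finite
  have hβi : IsIntegral k β := .of_finite k β
  have hβiF : IsIntegral F β := .of_finite F β
  set c := (minpoly F β).natDegree with hc
  have hc_pos : 0 < c := minpoly.natDegree_pos hβiF
  have hc_le : c ≤ e := by
    have hdvd := minpoly.dvd_map_of_isScalarTower k F β
    have hne : (minpoly k β).map (algebraMap k F) ≠ 0 := (minpoly.monic hβi).map _ |>.ne_zero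
    calc c ≤ ((minpoly k β).map (algebraMap k F)).natDegree := natDegree_le_of_dvd hdvd hne
      _ = e := by rw [natDegree_map, hβ]
  -- the tower `k ⊆ F ⊆ F(β)` and `k(β) ⊆ F(β)`
  set Fβ : IntermediateField F L := IntermediateField.adjoin F ({β} : Set L) with hFβ
  set m := Module.finrank k F with hm
  have hE : Module.finrank k (IntermediateField.restrictScalars k Fβ) = m * c := by
    rw [hc, ← IntermediateField.adjoin.finrank hβiF]
    exact (Module.finrank_mul_finrank k F Fβ).symm
  have hle : k⟮β⟯ ≤ IntermediateField.restrictScalars k Fβ := by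
    rw [IntermediateField.adjoin_simple_le_iff]
    exact IntermediateField.mem_adjoin_simple_self (↥F) β
  have hdvd : e ∣ m * c := by
    rw [← hE, ← hβ, ← IntermediateField.adjoin.finrank hβi]
    exact IntermediateField.finrank_dvd_of_le_right hle
  rcases (Nat.Prime.dvd_mul he).mp hdvd with h | h
  · -- `e ∣ [F : k]`: then `β ∈ F`
    left
    obtain ⟨j, hj⟩ := h
    haveI : Fintype k⟮β⟯ := Fintype.ofFinite _
    have hq : Nat.card k⟮β⟯ = Nat.card k ^ e := by
      rw [Module.natCard_eq_pow_finrank (K := k), IntermediateField.adjoin.finrank hβi, hβ]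
    have hpow : β ^ Nat.card k ^ e = β := by
      have h1 := FiniteField.pow_card (⟨β, IntermediateField.mem_adjoin_simple_self k β⟩ : k⟮β⟯)
      rw [← Nat.card_eq_fintype_card, hq] at h1
      exact congrArg Subtype.val h1
    have hpow' : ∀ i : ℕ, β ^ (Nat.card k ^ e) ^ i = β := by
      intro i
      induction i with
      | zero => simp
      | succ i ih => rw [pow_succ, pow_mul, ih, hpow]
    have hF : Nat.card F = (Nat.card k ^ e) ^ j := by
      rw [Module.natCard_eq_pow_finrank (K := k), ← hm, hj, pow_mul]
    have hmem : β ∈ F := mem_of_pow_natCard_eq F (by rw [hF, hpow'])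
    rw [hc, minpoly.natDegree_eq_one_iff]
    exact ⟨⟨β, hmem⟩, rfl⟩
  · right
    exact le_antisymm hc_le (Nat.le_of_dvd hc_pos h)

/-- Over a finite field there are monic irreducible polynomials of every positive degree `n`:
the minimal polynomial of a primitive element of the degree-`n` extension
`FiniteField.Extension k p n`. [folklore] -/
theorem exists_irreducible_natDegree_eq (k : Type*) [Field k] [Finite k] (n : ℕ) (hn : n ≠ 0) :
    ∃ P : k[X], Irreducible P ∧ P.Monic ∧ P.natDegree = n := by
  obtain ⟨p, hchar⟩ := CharP.exists k
  haveI : Fact p.Prime := ⟨CharP.char_is_prime k p⟩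
  haveI : NeZero n := ⟨hn⟩
  let E := FiniteField.Extension k p n
  obtain ⟨α, hα⟩ := Field.exists_primitive_element k E
  have hαi : IsIntegral k α := .of_finite k α
  refine ⟨minpoly k α, minpoly.irreducible hαi, minpoly.monic hαi, ?_⟩
  rw [(Field.primitive_element_iff_minpoly_natDegree_eq k α).mp hα,
    FiniteField.finrank_extension]

/-- A constructible subset of the prime spectrum of a domain which contains the generic point
contains a non-empty basic open subset: writing it as a finite union of sets
`V(g₁, …, gₙ) ∖ V(f)`, the generic point lies in one of them, forcing `gᵢ = 0` and `f ≠ 0`,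
so that piece is `D(f)`. [folklore] -/
theorem exists_basicOpen_subset_of_isConstructible {R : Type*} [CommRing R] [IsDomain R]
    {s : Set (PrimeSpectrum R)} (hs : Topology.IsConstructible s)
    (h0 : (⟨⊥, Ideal.isPrime_bot⟩ : PrimeSpectrum R) ∈ s) :
    ∃ g : R, g ≠ 0 ∧ (PrimeSpectrum.basicOpen g : Set (PrimeSpectrum R)) ⊆ s := by
  classical
  obtain ⟨S, rfl⟩ := PrimeSpectrum.exists_constructibleSetData_iff.mpr hs
  simp only [PrimeSpectrum.ConstructibleSetData.toSet, Set.mem_iUnion] at h0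
  obtain ⟨C, hC, hC0⟩ := h0
  simp only [PrimeSpectrum.BasicConstructibleSetData.toSet, Set.mem_sdiff,
    PrimeSpectrum.mem_zeroLocus, Set.range_subset_iff, SetLike.mem_coe, Ideal.mem_bot,
    Set.singleton_subset_iff] at hC0
  refine ⟨C.f, hC0.2, ?_⟩
  intro p hp
  simp only [PrimeSpectrum.ConstructibleSetData.toSet, Set.mem_iUnion]
  refine ⟨C, hC, ?_, ?_⟩
  · simp only [PrimeSpectrum.mem_zeroLocus, Set.range_subset_iff, SetLike.mem_coe]
    intro i
    rw [hC0.1 i]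
    exact zero_mem _
  · simpa using hp

/-- **Rank one at a rational fibre.** Let `B` be a finite flat unramified `A`-algebra, `t` a
prime of `B` which is the only prime over `u = t ∩ A`, and suppose every element of `B` is
congruent modulo `t` to a "fraction" `a / a'` of elements of `A` with `a' ∉ u`. Then `B` has
rank one at `u`: the fibre `κ(u) ⊗_A B` is reduced with a single point, which pulls back to `t`,
so `1 ⊗ s = 0` for `s ∈ t` and `κ(u) → κ(u) ⊗_A B` is onto. [folklore] -/
theorem rankAtStalk_eq_one_of_forall_exists {A B : Type*} [CommRing A] [CommRing B] [Algebra A B]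
    [Module.Finite A B] [Module.Flat A B] [Algebra.FormallyUnramified A B]
    (t : PrimeSpectrum B)
    (huniq : ∀ t' : PrimeSpectrum B, PrimeSpectrum.comap (algebraMap A B) t' =
      PrimeSpectrum.comap (algebraMap A B) t → t' = t)
    (hrat : ∀ s : B, ∃ a a' : A, algebraMap A B a' ∉ t.asIdeal ∧
      a' • s - algebraMap A B a ∈ t.asIdeal) :
    Module.rankAtStalk B (PrimeSpectrum.comap (algebraMap A B) t) = 1 := by
  classical
  set u := PrimeSpectrum.comap (algebraMap A B) t with hu
  let K := u.asIdeal.ResidueField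
  let Fu := u.asIdeal.Fiber B
  rw [Module.rankAtStalk_eq]
  change Module.finrank K Fu = 1
  haveI : IsReduced Fu := Algebra.FormallyUnramified.isReduced_of_field K Fu
  -- every prime of the fibre ring pulls back to `t`
  have hprime : ∀ Q : PrimeSpectrum Fu,
      Q.asIdeal.comap (Algebra.TensorProduct.includeRight (R := A) (A := K) (B := B)).toRingHom =
        t.asIdeal := by
    intro Q
    have h := huniq ((PrimeSpectrum.preimageEquivFiber A B u).symm Q).1
      ((PrimeSpectrum.preimageEquivFiber A B u).symm Q).2
    exact congrArg PrimeSpectrum.asIdeal h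
  -- hence `1 ⊗ s = 0` for `s ∈ t`
  have hzero : ∀ s ∈ t.asIdeal, (1 ⊗ₜ[A] s : Fu) = 0 := by
    intro s hs
    apply IsReduced.eq_zero
    rw [nilpotent_iff_mem_prime]
    intro J hJ
    have := hprime ⟨J, hJ⟩
    have hs' : s ∈ J.comap
        (Algebra.TensorProduct.includeRight (R := A) (A := K) (B := B)).toRingHom := this ▸ hs
    simpa using hs'
  -- the fibre is nontrivial
  haveI : Nontrivial Fu := by
    obtain ⟨Q⟩ : Nonempty (PrimeSpectrum Fu) :=
      ⟨PrimeSpectrum.preimageEquivFiber A B u ⟨t, rfl⟩⟩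
    exact Q.nontrivial
  -- `κ(u) → κ(u) ⊗ B` is surjective
  have hsurj : Function.Surjective (algebraMap K Fu) := by
    have hone : ∀ s : B, (1 ⊗ₜ[A] s : Fu) ∈ (algebraMap K Fu).range := by
      intro s
      obtain ⟨a, a', ha', h⟩ := hrat s
      have ha'K : algebraMap A K a' ≠ 0 := by
        rw [ne_eq, Ideal.algebraMap_residueField_eq_zero]
        exact ha'
      have h1 : (1 ⊗ₜ[A] (a' • s - algebraMap A B a) : Fu) = 0 := hzero _ h
      rw [tmul_sub, sub_eq_zero, tmul_smul, ← Algebra.TensorProduct.algebraMap_apply'] at h1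
      have h2 : (algebraMap K Fu (algebraMap A K a')) * (1 ⊗ₜ[A] s) = algebraMap K Fu
          (algebraMap A K a) := by
        rw [← IsScalarTower.algebraMap_apply, ← IsScalarTower.algebraMap_apply,
          ← Algebra.smul_def]
        exact h1
      refine ⟨(algebraMap A K a')⁻¹ * algebraMap A K a, ?_⟩
      rw [map_mul, ← h2, ← mul_assoc, ← map_mul, inv_mul_cancel₀ ha'K, map_one, one_mul]
    intro x
    induction x using TensorProduct.induction_on with
    | zero => exact ⟨0, map_zero _⟩
    | tmul κ s =>
      obtain ⟨y, hy⟩ := hone s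
      refine ⟨κ * y, ?_⟩
      rw [map_mul, hy, Algebra.algebraMap_eq_smul_one, smul_mul_assoc, one_mul,
        TensorProduct.smul_tmul', smul_eq_mul, mul_one]
    | add x y hx hy =>
      obtain ⟨x, rfl⟩ := hx
      obtain ⟨y, rfl⟩ := hy
      exact ⟨x + y, map_add _ _ _⟩
  have hbij : Function.Bijective (algebraMap K Fu) := ⟨(algebraMap K Fu).injective, hsurj⟩
  have e : K ≃ₗ[K] Fu := LinearEquiv.ofBijective (Algebra.linearMap K Fu) hbij
  rw [← e.finrank_eq, Module.finrank_self]

/-- Elements of the subfield of a field `L` generated by the image of a ring `A` are quotients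
`a / a'` of images of elements of `A` with `a' ↦ a' ≠ 0` (the image of `A` is a subring, whose
fraction field inside `L` is that subfield). [folklore] -/
theorem exists_mul_eq_of_mem_closure {A L : Type*} [CommRing A] [Field L] [Algebra A L] {y : L}
    (hy : y ∈ Subfield.closure (Set.range (algebraMap A L))) :
    ∃ a a' : A, algebraMap A L a' ≠ 0 ∧ algebraMap A L a' * y = algebraMap A L a := by
  rw [Subfield.mem_closure_iff] at hy
  obtain ⟨y₁, hy₁, z₁, hz₁, rfl⟩ := hy
  rw [← RingHom.coe_range, Subring.closure_eq] at hy₁ hz₁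
  obtain ⟨a₁, rfl⟩ := RingHom.mem_range.mp hy₁
  obtain ⟨a₂, rfl⟩ := RingHom.mem_range.mp hz₁
  by_cases h : algebraMap A L a₂ = 0
  · exact ⟨0, 1, by simp, by simp [h]⟩
  · exact ⟨a₁, a₂, h, mul_div_cancel₀ _ h⟩

/-- Polynomials with coefficients in `A`, evaluated at an element of the subfield generated by
the image of `A`, stay in that subfield. [folklore] -/
theorem aeval_mem_closure {A L : Type*} [CommRing A] [Field L] [Algebra A L] {x : L}
    (hx : x ∈ Subfield.closure (Set.range (algebraMap A L))) (p : A[X]) :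
    aeval x p ∈ Subfield.closure (Set.range (algebraMap A L)) := by
  rw [aeval_eq_sum_range]
  refine Subfield.sum_mem _ fun i _ => ?_
  rw [Algebra.smul_def]
  exact mul_mem (Subfield.subset_closure ⟨_, rfl⟩) (pow_mem hx i)

/-- In a standard étale `A`-algebra `S` (Mathlib `StandardEtalePresentation`: generator `x`,
`S ≅ (A[X]/(f))[1/g]`) mapped to a field `L`: if the image of the generator lies in the subfield
generated by the image of `A`, so does the image of every element `s ∈ S`, because
`s · g(x)ⁿ = p(x)` for some `p ∈ A[X]` and `g(x)` is a unit. [folklore] -/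
theorem algebraMap_mem_closure {A S L : Type*} [CommRing A] [CommRing S] [Field L] [Algebra A S]
    [Algebra A L] [Algebra S L] [IsScalarTower A S L] (P : StandardEtalePresentation A S)
    (hx : algebraMap S L P.x ∈ Subfield.closure (Set.range (algebraMap A L))) (s : S) :
    algebraMap S L s ∈ Subfield.closure (Set.range (algebraMap A L)) := by
  obtain ⟨p, n, e⟩ := P.exists_mul_aeval_x_g_pow_eq_aeval_x s
  let φ : S →ₐ[A] L := IsScalarTower.toAlgHom A S L
  have e' : algebraMap S L s * aeval (algebraMap S L P.x) P.g ^ n =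
      aeval (algebraMap S L P.x) p := by
    have := congrArg φ e
    simpa [φ, map_mul, map_pow, ← aeval_algHom_apply] using this
  have hg : aeval (algebraMap S L P.x) P.g ≠ 0 := by
    have hu : IsUnit (aeval P.x P.g) := P.hasMap.2
    have := hu.map φ
    rw [← aeval_algHom_apply] at this
    exact this.ne_zero
  have : algebraMap S L s =
      aeval (algebraMap S L P.x) p / aeval (algebraMap S L P.x) P.g ^ n := by
    rw [eq_div_iff (pow_ne_zero _ hg), e']
  rw [this]
  exact div_mem (aeval_mem_closure hx p) (pow_mem (aeval_mem_closure hx P.g) n)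

/-- **Rank one from a rational generator.** Let `B` be finite, flat and unramified over `A` with
`Spec B → Spec A` injective, `S` an `A`-algebra under `B` carrying a standard étale presentation
over `A` (generator `x`), and `L` a field under `S`. If the image of `x` in `L` lies in the
subfield generated by the image of `A`, then `B` has rank one at the prime `u = ker (A → L)`:
every element of `B` is then "`A`-rational modulo `t = ker (B → L)`", and
`rankAtStalk_eq_one_of_forall_exists` applies. [folklore] -/
theorem exists_rankAtStalk_eq_one {A B S L : Type*} [CommRing A] [CommRing B] [CommRing S]
    [Field L] [Algebra A B] [Module.Finite A B] [Module.Flat A B] [Algebra.FormallyUnramified A B]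
    [Algebra A S] [Algebra B S] [IsScalarTower A B S] (P : StandardEtalePresentation A S)
    [Algebra A L] [Algebra B L] [Algebra S L] [IsScalarTower A S L] [IsScalarTower B S L]
    [IsScalarTower A B L]
    (hinj : Function.Injective (PrimeSpectrum.comap (algebraMap A B)))
    (hx : algebraMap S L P.x ∈ Subfield.closure (Set.range (algebraMap A L))) :
    ∃ u : PrimeSpectrum A, Module.rankAtStalk B u = 1 := by
  let t : PrimeSpectrum B := ⟨RingHom.ker (algebraMap B L), RingHom.ker_isPrime _⟩
  refine ⟨PrimeSpectrum.comap (algebraMap A B) t,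
    rankAtStalk_eq_one_of_forall_exists t (fun t' h => hinj h) fun s => ?_⟩
  have hs : algebraMap B L s ∈ Subfield.closure (Set.range (algebraMap A L)) := by
    rw [IsScalarTower.algebraMap_apply B S L]
    exact algebraMap_mem_closure P hx _
  obtain ⟨a, a', ha', h⟩ := exists_mul_eq_of_mem_closure hs
  refine ⟨a, a', ?_, ?_⟩
  · change algebraMap A B a' ∉ RingHom.ker (algebraMap B L)
    rwa [RingHom.mem_ker, ← IsScalarTower.algebraMap_apply]
  · change a' • s - algebraMap A B a ∈ RingHom.ker (algebraMap B L)
    rw [RingHom.mem_ker, map_sub, Algebra.smul_def, map_mul, ← IsScalarTower.algebraMap_apply,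
      ← IsScalarTower.algebraMap_apply, h, sub_self]

end Summit.ResolutionOfSingularities.ResolutionOfSingularities.Theorems.WildQuotientResolution.Birational
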